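import Mathlib
import Summits.NavierStokesRegularity.NavierStokesRegularity.Theorems.EulerZoomLiouvillePowerGaugeEulerLiouvilleQVorticityInequality
import HarnessLib

/-!
# The MOVING EXTERIOR WEIGHT `Θ̂(t, y) = ϑ(|y|²/(R₀²(c−t)^{2n}) − 1)` for self-similar zooms
# (helper of the DSS vorticity-decay stratum of the crux `EulerZoomLiouville.PowerGaugeEulerLiouville`,
# route №10, item stmt-NavierStokesRegularity-19832)

Helper file (theorems only; `--supports stmt-NavierStokesRegularity-19832`). Seat ns-typeII-p3 (cell
ns-regularity-ideate §B, D-0081). The weight used in the sequel `…DSSVorticityDecay.lean`: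
`Θ̂(t, y) = ϑ(|y|² R₀⁻² (c − t)^{−2n} − 1)` with `ϑ = Real.smoothTransition` (smooth, monotone, `= 0` on
`(−∞, 0]`, `= 1` on `[1, ∞)`), i.e. `Θ̂ = 0` on the ball `|y| ≤ R₀ (c−t)^n`, `= 1` off the ball
`|y| ≥ √2 R₀ (c−t)^n`; here `c` is the blow-up time and `n = 1/(2+ρ)` the length exponent of the class
scaling. This file proves: joint smoothness on `[0, T]` for `T < c` (`isSmoothSpaceTimeOn_weight`); the
time and space derivative formulas (`timeDerivWithin_weight`, `fderiv_weight_apply`); `0 ≤ Θ̂ ≤ 1`, the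
support facts; bounded derivatives on `[0, T]` (`exists_bound_deriv_weight`); and the SIGN LEMMA
(`weight_outgoing`): if `(c − t)|u(t, y)| ≤ n |y|` for `|y| ≥ R₀ (c−t)^n` then the material derivative
`∂ₜΘ̂ + DΘ̂[u]` is nonnegative everywhere — the Eulerian form of Chae–Tsai's boundary condition
`V_r ≥ −|y|/(α+1)` (MRL 21 (2014), proof of Thm 2.2), since `ϑ' ≥ 0` and the shells `|y| = R (c−t)^n`
move inward at speed `n R (c−t)^{n−1}`.

WHAT THIS IS NOT: not NS, not the crux — calculus of one explicit test function. [folklore]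
-/

noncomputable section

-- the summit and its single problem share the name `NavierStokesRegularity` (D-0017 nested layout)
set_option linter.dupNamespace false

open Set Function Filter Topology MeasureTheory Metric
open scoped NNReal ENNReal InnerProductSpace RealInnerProductSpace

namespace Summit.NavierStokesRegularity.NavierStokesRegularity.Theorems.PowerGaugeEulerLiouville.VorticityDecay

open Literature.Analysis Literature.Analysis.FluidPDE

/-! ## The profile `ϑ = Real.smoothTransition` and its derivative -/

/-- `ϑ` is differentiable with derivative `deriv ϑ`. [folklore] -/
theorem hasDerivAt_smoothTransition (x : ℝ) :
    HasDerivAt Real.smoothTransition (deriv Real.smoothTransition x) x :=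
  ((Real.smoothTransition.contDiff (n := 1)).differentiable one_ne_zero x).hasDerivAt

/-- `ϑ' ≥ 0` (monotone). [folklore] -/
theorem deriv_smoothTransition_nonneg (x : ℝ) : 0 ≤ deriv Real.smoothTransition x :=
  (hasDerivAt_smoothTransition x).nonneg_of_monotone Real.smoothTransition.monotone

/-- `ϑ' = 0` on `(−∞, 0)`. [folklore] -/
theorem deriv_smoothTransition_of_neg {x : ℝ} (hx : x < 0) : deriv Real.smoothTransition x = 0 := by
  have h : ∀ᶠ y in 𝓝 x, Real.smoothTransition y = (fun _ => (0 : ℝ)) y :=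
    (eventually_lt_nhds hx).mono fun y hy => Real.smoothTransition.zero_of_nonpos hy.le
  rw [Filter.EventuallyEq.deriv_eq h, deriv_const]

/-- `ϑ' = 0` on `(1, ∞)`. [folklore] -/
theorem deriv_smoothTransition_of_one_lt {x : ℝ} (hx : 1 < x) : deriv Real.smoothTransition x = 0 := by
  have h : ∀ᶠ y in 𝓝 x, Real.smoothTransition y = (fun _ => (1 : ℝ)) y :=
    (eventually_gt_nhds hx).mono fun y hy => Real.smoothTransition.one_of_one_le hy.le
  rw [Filter.EventuallyEq.deriv_eq h, deriv_const]

/-- `ϑ'` is bounded. [folklore] -/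
theorem exists_bound_deriv_smoothTransition : ∃ S : ℝ, 0 ≤ S ∧ ∀ x, |deriv Real.smoothTransition x| ≤ S := by
  have hc : Continuous (deriv Real.smoothTransition) :=
    (Real.smoothTransition.contDiff (n := 1)).continuous_deriv le_rfl
  obtain ⟨S, hS⟩ := isCompact_Icc.exists_bound_of_continuousOn (hc.continuousOn (s := Icc (0 : ℝ) 1))
  refine ⟨max S 0, le_max_right _ _, fun x => ?_⟩
  by_cases h0 : x < 0
  · rw [deriv_smoothTransition_of_neg h0, abs_zero]; exact le_max_right _ _
  by_cases h1 : 1 < x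
  · rw [deriv_smoothTransition_of_one_lt h1, abs_zero]; exact le_max_right _ _
  · have := hS x ⟨not_lt.1 h0, not_lt.1 h1⟩
    rw [Real.norm_eq_abs] at this
    exact this.trans (le_max_left _ _)

/-! ## The weight: smoothness and derivative formulas -/

section Weight

variable {R₀ n c T : ℝ}

/-- The time factor `h(t) = R₀⁻² (c − t)^{−2n}` has derivative `h'(t) = 2n (c−t)⁻¹ h(t)` for `t < c`.
[folklore] -/
theorem hasDerivAt_timeFactor (R₀ : ℝ) {t : ℝ} (ht : t < c) (n : ℝ) :
    HasDerivAt (fun s => (R₀ ^ 2)⁻¹ * (c - s) ^ (-(2 * n)))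
      ((R₀ ^ 2)⁻¹ * (2 * n * (c - t)⁻¹ * (c - t) ^ (-(2 * n)))) t := by
  have hct : 0 < c - t := sub_pos.2 ht
  have h1 : HasDerivAt (fun s => c - s) (-1) t := by
    simpa using (hasDerivAt_id t).const_sub c
  have h2 := h1.rpow_const (p := -(2 * n)) (Or.inl hct.ne')
  have h3 := h2.const_mul (R₀ ^ 2)⁻¹
  have e : -1 * -(2 * n) * (c - t) ^ (-(2 * n) - 1) = 2 * n * (c - t)⁻¹ * (c - t) ^ (-(2 * n)) := by
    rw [Real.rpow_sub hct, Real.rpow_one]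
    field_simp
  rw [e] at h3
  exact h3

/-- **Joint smoothness** of `Θ̂` on `[0, T]` for `T < c`. [folklore] -/
theorem isSmoothSpaceTimeOn_weight (R₀ : ℝ) (hTc : T < c) (n : ℝ) :
    IsSmoothSpaceTimeOn (Icc 0 T) (fun t (y : EuclideanSpace ℝ (Fin 3)) =>
      Real.smoothTransition (‖y‖ ^ 2 * ((R₀ ^ 2)⁻¹ * (c - t) ^ (-(2 * n))) - 1)) := by
  unfold IsSmoothSpaceTimeOn
  have hg : ContDiffOn ℝ ((⊤ : ℕ∞) : WithTop ℕ∞) (fun z : ℝ × EuclideanSpace ℝ (Fin 3) =>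
      ‖z.2‖ ^ 2 * ((R₀ ^ 2)⁻¹ * (c - z.1) ^ (-(2 * n))) - 1) (Icc 0 T ×ˢ univ) := by
    refine ContDiffOn.sub (ContDiffOn.mul ?_ ?_) contDiffOn_const
    · exact (contDiff_snd.norm_sq ℝ).contDiffOn
    · refine contDiffOn_const.mul (ContDiffOn.rpow_const_of_ne ?_ fun z hz => ?_)
      · exact (contDiff_const.sub contDiff_fst).contDiffOn
      · have : z.1 ≤ T := (mem_prod.1 hz).1.2
        exact (sub_pos.2 (this.trans_lt hTc)).ne'
  exact Real.smoothTransition.contDiff.comp_contDiffOn hg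

/-- **Time derivative of the weight** within `[0, T]` (`T < c`, `0 < T`):
`∂ₜΘ̂(t, y) = ϑ'(g) · |y|² h'(t)`, `g = |y|² h(t) − 1`, `h'(t) = 2n (c−t)⁻¹ h(t)`. [folklore] -/
theorem timeDerivWithin_weight (R₀ : ℝ) (hT : 0 < T) (hTc : T < c) (n : ℝ) {t : ℝ} (ht : t ∈ Icc 0 T)
    (y : EuclideanSpace ℝ (Fin 3)) :
    FluidPDE.timeDerivWithin (Icc 0 T) (fun s (y : EuclideanSpace ℝ (Fin 3)) =>
      Real.smoothTransition (‖y‖ ^ 2 * ((R₀ ^ 2)⁻¹ * (c - s) ^ (-(2 * n))) - 1)) t y =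
      deriv Real.smoothTransition (‖y‖ ^ 2 * ((R₀ ^ 2)⁻¹ * (c - t) ^ (-(2 * n))) - 1) *
        (‖y‖ ^ 2 * ((R₀ ^ 2)⁻¹ * (2 * n * (c - t)⁻¹ * (c - t) ^ (-(2 * n))))) := by
  have htc : t < c := ht.2.trans_lt hTc
  have hg : HasDerivAt (fun s => ‖y‖ ^ 2 * ((R₀ ^ 2)⁻¹ * (c - s) ^ (-(2 * n))) - 1)
      (‖y‖ ^ 2 * ((R₀ ^ 2)⁻¹ * (2 * n * (c - t)⁻¹ * (c - t) ^ (-(2 * n))))) t := by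
    simpa using ((hasDerivAt_timeFactor R₀ htc n).const_mul (‖y‖ ^ 2)).sub_const 1
  have h : HasDerivAt (fun s => Real.smoothTransition (‖y‖ ^ 2 * ((R₀ ^ 2)⁻¹ * (c - s) ^ (-(2 * n))) - 1))
      (deriv Real.smoothTransition (‖y‖ ^ 2 * ((R₀ ^ 2)⁻¹ * (c - t) ^ (-(2 * n))) - 1) *
        (‖y‖ ^ 2 * ((R₀ ^ 2)⁻¹ * (2 * n * (c - t)⁻¹ * (c - t) ^ (-(2 * n)))))) t :=
    (hasDerivAt_smoothTransition _).comp t hg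
  rw [timeDerivWithin_apply, (h.hasDerivWithinAt (s := Icc 0 T)).derivWithin (uniqueDiffOn_Icc hT t ht)]

/-- **Space derivative of the weight**: `DΘ̂(t, ·)(y)[w] = ϑ'(g) · 2⟪y, w⟫ h(t)`. [folklore] -/
theorem fderiv_weight_apply (t : ℝ) (n : ℝ) (y w : EuclideanSpace ℝ (Fin 3)) :
    fderiv ℝ (fun y : EuclideanSpace ℝ (Fin 3) =>
      Real.smoothTransition (‖y‖ ^ 2 * ((R₀ ^ 2)⁻¹ * (c - t) ^ (-(2 * n))) - 1)) y w =
      deriv Real.smoothTransition (‖y‖ ^ 2 * ((R₀ ^ 2)⁻¹ * (c - t) ^ (-(2 * n))) - 1) *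
        (2 * ⟪y, w⟫ * ((R₀ ^ 2)⁻¹ * (c - t) ^ (-(2 * n)))) := by
  have h1 : HasFDerivAt (fun y : EuclideanSpace ℝ (Fin 3) => ‖y‖ ^ 2) (2 • innerSL ℝ y) y := by
    have := (hasFDerivAt_id (𝕜 := ℝ) y).norm_sq
    simpa using this
  have h2 : HasFDerivAt (fun y : EuclideanSpace ℝ (Fin 3) =>
      ‖y‖ ^ 2 * ((R₀ ^ 2)⁻¹ * (c - t) ^ (-(2 * n))) - 1)
      (((R₀ ^ 2)⁻¹ * (c - t) ^ (-(2 * n))) • (2 • innerSL ℝ y)) y := by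
    have := (h1.mul_const ((R₀ ^ 2)⁻¹ * (c - t) ^ (-(2 * n)))).sub_const 1
    simpa [smul_smul, mul_comm] using this
  have h3 : HasFDerivAt (fun y : EuclideanSpace ℝ (Fin 3) =>
      Real.smoothTransition (‖y‖ ^ 2 * ((R₀ ^ 2)⁻¹ * (c - t) ^ (-(2 * n))) - 1))
      (deriv Real.smoothTransition (‖y‖ ^ 2 * ((R₀ ^ 2)⁻¹ * (c - t) ^ (-(2 * n))) - 1) •
        (((R₀ ^ 2)⁻¹ * (c - t) ^ (-(2 * n))) • (2 • innerSL ℝ y))) y :=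
    (hasDerivAt_smoothTransition _).comp_hasFDerivAt y h2
  rw [h3.fderiv]
  simp only [smul_apply, innerSL_apply_apply, smul_eq_mul, nsmul_eq_mul, Nat.cast_ofNat]
  ring

/-- **Values of the weight**: `0 ≤ Θ̂ ≤ 1`; `Θ̂(t, y) ≠ 0 ⇒ R₀²(c−t)^{2n} < |y|²`; `Θ̂(t, y) = 1` when
`2R₀²(c−t)^{2n} ≤ |y|²` (`t < c`). [folklore] -/
theorem weight_values (hR : 0 < R₀) {t : ℝ} (htc : t < c) (n : ℝ) (y : EuclideanSpace ℝ (Fin 3)) :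
    (0 ≤ Real.smoothTransition (‖y‖ ^ 2 * ((R₀ ^ 2)⁻¹ * (c - t) ^ (-(2 * n))) - 1) ∧
      Real.smoothTransition (‖y‖ ^ 2 * ((R₀ ^ 2)⁻¹ * (c - t) ^ (-(2 * n))) - 1) ≤ 1) ∧
    (Real.smoothTransition (‖y‖ ^ 2 * ((R₀ ^ 2)⁻¹ * (c - t) ^ (-(2 * n))) - 1) ≠ 0 →
      R₀ ^ 2 * (c - t) ^ (2 * n) < ‖y‖ ^ 2) ∧
    (2 * (R₀ ^ 2 * (c - t) ^ (2 * n)) ≤ ‖y‖ ^ 2 →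
      Real.smoothTransition (‖y‖ ^ 2 * ((R₀ ^ 2)⁻¹ * (c - t) ^ (-(2 * n))) - 1) = 1) := by
  have hct : 0 < c - t := sub_pos.2 htc
  have hP : 0 < R₀ ^ 2 * (c - t) ^ (2 * n) := by positivity
  have hinv : (R₀ ^ 2)⁻¹ * (c - t) ^ (-(2 * n)) = (R₀ ^ 2 * (c - t) ^ (2 * n))⁻¹ := by
    rw [Real.rpow_neg hct.le, mul_inv]
  refine ⟨⟨Real.smoothTransition.nonneg _, Real.smoothTransition.le_one _⟩, fun hne => ?_, fun hle => ?_⟩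
  · by_contra hcon
    apply hne
    apply Real.smoothTransition.zero_of_nonpos
    rw [hinv, sub_nonpos, ← div_eq_mul_inv, div_le_one hP]
    exact not_lt.1 hcon
  · apply Real.smoothTransition.one_of_one_le
    rw [hinv, le_sub_iff_add_le, ← div_eq_mul_inv, le_div_iff₀ hP]
    linarith

/-- **Bounded derivatives of the weight on `[0, T]`** (`0 ≤ T < c`): `|∂ₜΘ̂|, ‖DΘ̂‖ ≤ M`. Both
derivatives carry the factor `ϑ'(g)`, which vanishes unless `0 ≤ g ≤ 1`, i.e. unless
`R₀²(c−t)^{2n} ≤ |y|² ≤ 2R₀²(c−t)^{2n}`; there `|y|² h ≤ 2` and `|y| h ≤ √2 R₀⁻¹ (c−t)^{−n}`. We argue by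
compactness instead: the derivatives are continuous on `[0, T] × B̄(0, ρ)` and vanish off that set for
`ρ² = 2R₀²c^{2n}`. [folklore] -/
theorem exists_bound_deriv_weight (hR : 0 < R₀) (hT : 0 < T) (hTc : T < c) (hn : 0 ≤ n) :
    ∃ M : ℝ, ∀ t ∈ Icc 0 T, ∀ y : EuclideanSpace ℝ (Fin 3),
      |FluidPDE.timeDerivWithin (Icc 0 T) (fun s (y : EuclideanSpace ℝ (Fin 3)) =>
          Real.smoothTransition (‖y‖ ^ 2 * ((R₀ ^ 2)⁻¹ * (c - s) ^ (-(2 * n))) - 1)) t y| ≤ M ∧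
        ‖fderiv ℝ (fun y : EuclideanSpace ℝ (Fin 3) =>
          Real.smoothTransition (‖y‖ ^ 2 * ((R₀ ^ 2)⁻¹ * (c - t) ^ (-(2 * n))) - 1)) y‖ ≤ M := by
  have hS : UniqueDiffOn ℝ (Icc 0 T) := uniqueDiffOn_Icc hT
  have hΘ := isSmoothSpaceTimeOn_weight (T := T) R₀ hTc n
  -- continuity of both derivatives on `[0, T] × ℝ³`
  have hct : ContinuousOn (fun z : ℝ × EuclideanSpace ℝ (Fin 3) =>
      FluidPDE.timeDerivWithin (Icc 0 T) (fun s (y : EuclideanSpace ℝ (Fin 3)) =>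
        Real.smoothTransition (‖y‖ ^ 2 * ((R₀ ^ 2)⁻¹ * (c - s) ^ (-(2 * n))) - 1)) z.1 z.2)
      (Icc 0 T ×ˢ univ) := hΘ.continuousOn_timeDerivWithin hS
  have hcx : ContinuousOn (fun z : ℝ × EuclideanSpace ℝ (Fin 3) =>
      fderiv ℝ (fun y : EuclideanSpace ℝ (Fin 3) =>
        Real.smoothTransition (‖y‖ ^ 2 * ((R₀ ^ 2)⁻¹ * (c - z.1) ^ (-(2 * n))) - 1)) z.2)
      (Icc 0 T ×ˢ univ) := hΘ.continuousOn_fderiv_slice hS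
  -- the compact set and the bounds there
  set ρ : ℝ := Real.sqrt (2 * (R₀ ^ 2 * c ^ (2 * n))) + 1 with hρ
  have hK : IsCompact (Icc 0 T ×ˢ closedBall (0 : EuclideanSpace ℝ (Fin 3)) ρ) :=
    isCompact_Icc.prod (isCompact_closedBall _ _)
  obtain ⟨M₁, hM₁⟩ := hK.exists_bound_of_continuousOn (hct.mono (prod_mono le_rfl (subset_univ _)))
  obtain ⟨M₂, hM₂⟩ := hK.exists_bound_of_continuousOn (hcx.mono (prod_mono le_rfl (subset_univ _)))
  refine ⟨max (max M₁ M₂) 0, fun t ht y => ?_⟩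
  have htc : t < c := ht.2.trans_lt hTc
  have hc0 : 0 < c := by linarith [ht.1]
  by_cases hy : y ∈ closedBall (0 : EuclideanSpace ℝ (Fin 3)) ρ
  · have h1 := hM₁ (t, y) ⟨ht, hy⟩
    have h2 := hM₂ (t, y) ⟨ht, hy⟩
    simp only [Real.norm_eq_abs] at h1
    exact ⟨h1.trans ((le_max_left _ _).trans (le_max_left _ _)),
      h2.trans ((le_max_right _ _).trans (le_max_left _ _))⟩
  · -- off the ball: `g > 1`, so `ϑ'(g) = 0` and both derivatives vanish
    have hyn : ρ < ‖y‖ := by simpa [mem_closedBall_zero_iff] using hy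
    have hρ0 : Real.sqrt (2 * (R₀ ^ 2 * c ^ (2 * n))) < ‖y‖ := by linarith
    have hy2 : 2 * (R₀ ^ 2 * c ^ (2 * n)) < ‖y‖ ^ 2 := by
      have h0 : 0 ≤ 2 * (R₀ ^ 2 * c ^ (2 * n)) := by positivity
      nlinarith [Real.sq_sqrt h0, Real.sqrt_nonneg (2 * (R₀ ^ 2 * c ^ (2 * n))), norm_nonneg y]
    have hmono : (c - t) ^ (2 * n) ≤ c ^ (2 * n) :=
      Real.rpow_le_rpow (sub_pos.2 htc).le (by linarith [ht.1]) (by positivity)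
    have hg : 1 < ‖y‖ ^ 2 * ((R₀ ^ 2)⁻¹ * (c - t) ^ (-(2 * n))) - 1 := by
      have hP : 0 < R₀ ^ 2 * (c - t) ^ (2 * n) := by positivity
      rw [Real.rpow_neg (sub_pos.2 htc).le, ← mul_inv, lt_sub_iff_add_lt, ← div_eq_mul_inv,
        lt_div_iff₀ hP]
      nlinarith
    have hd := deriv_smoothTransition_of_one_lt hg
    refine ⟨?_, ?_⟩
    · rw [timeDerivWithin_weight R₀ hT hTc n ht y, hd, zero_mul, abs_zero]
      exact le_max_right _ _
    · have hzero : fderiv ℝ (fun y : EuclideanSpace ℝ (Fin 3) =>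
          Real.smoothTransition (‖y‖ ^ 2 * ((R₀ ^ 2)⁻¹ * (c - t) ^ (-(2 * n))) - 1)) y = 0 := by
        ext w
        rw [fderiv_weight_apply t n y w, hd, zero_mul]
        rfl
      rw [hzero, norm_zero]
      exact le_max_right _ _

/-- **The sign lemma (outgoing shells).** If `(c − t) |u(t, y)| ≤ n |y|` whenever `|y| ≥ R₀ (c−t)^n`
(`t ∈ [0, T]`, `T < c`, `n ≥ 0`), then the material derivative of the weight along `u` is nonnegative:
`0 ≤ ∂ₜΘ̂ + DΘ̂[u]` on `[0, T] × ℝ³`. [folklore] -/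
theorem weight_outgoing (hR : 0 < R₀) (hT : 0 < T) (hTc : T < c)
    {v : ℝ → EuclideanSpace ℝ (Fin 3) → EuclideanSpace ℝ (Fin 3)}
    (hvel : ∀ t ∈ Icc 0 T, ∀ y, R₀ * (c - t) ^ n ≤ ‖y‖ → (c - t) * ‖v t y‖ ≤ n * ‖y‖)
    {t : ℝ} (ht : t ∈ Icc 0 T) (y : EuclideanSpace ℝ (Fin 3)) :
    0 ≤ FluidPDE.timeDerivWithin (Icc 0 T) (fun s (y : EuclideanSpace ℝ (Fin 3)) =>
          Real.smoothTransition (‖y‖ ^ 2 * ((R₀ ^ 2)⁻¹ * (c - s) ^ (-(2 * n))) - 1)) t y +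
        fderiv ℝ (fun y : EuclideanSpace ℝ (Fin 3) =>
          Real.smoothTransition (‖y‖ ^ 2 * ((R₀ ^ 2)⁻¹ * (c - t) ^ (-(2 * n))) - 1)) y (v t y) := by
  have htc : t < c := ht.2.trans_lt hTc
  have hct : 0 < c - t := sub_pos.2 htc
  rw [timeDerivWithin_weight R₀ hT hTc n ht y, fderiv_weight_apply t n y (v t y), ← mul_add]
  set h : ℝ := (R₀ ^ 2)⁻¹ * (c - t) ^ (-(2 * n)) with hh
  have hh0 : 0 < h := by positivity
  -- the bracket equals `2 h ((n/(c−t)) |y|² + ⟪y, v⟫)`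
  have e : ‖y‖ ^ 2 * ((R₀ ^ 2)⁻¹ * (2 * n * (c - t)⁻¹ * (c - t) ^ (-(2 * n)))) + 2 * ⟪y, v t y⟫ * h =
      2 * h * (n * (c - t)⁻¹ * ‖y‖ ^ 2 + ⟪y, v t y⟫) := by rw [hh]; ring
  rw [e]
  by_cases hy : R₀ * (c - t) ^ n ≤ ‖y‖
  · refine mul_nonneg (deriv_smoothTransition_nonneg _) (mul_nonneg (by positivity) ?_)
    have h1 := hvel t ht y hy
    have h2 : |⟪y, v t y⟫| ≤ ‖y‖ * ‖v t y‖ := abs_real_inner_le_norm _ _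
    have h3 : ‖y‖ * ‖v t y‖ ≤ n * (c - t)⁻¹ * ‖y‖ ^ 2 := by
      rw [show n * (c - t)⁻¹ * ‖y‖ ^ 2 = ‖y‖ * (n * ‖y‖ / (c - t)) by ring]
      exact mul_le_mul_of_nonneg_left ((le_div_iff₀' hct).2 h1) (norm_nonneg _)
    linarith [(abs_le.1 h2).1]
  · -- inside the ball the weight is locally zero: `g < 0`, `ϑ'(g) = 0`
    have hy' : ‖y‖ < R₀ * (c - t) ^ n := not_le.1 hy
    have hg : ‖y‖ ^ 2 * ((R₀ ^ 2)⁻¹ * (c - t) ^ (-(2 * n))) - 1 < 0 := by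
      have hP : 0 < R₀ ^ 2 * (c - t) ^ (2 * n) := by positivity
      have hy2 : ‖y‖ ^ 2 < R₀ ^ 2 * (c - t) ^ (2 * n) := by
        have e2 : R₀ ^ 2 * (c - t) ^ (2 * n) = (R₀ * (c - t) ^ n) ^ 2 := by
          rw [mul_pow, ← Real.rpow_natCast ((c - t) ^ n) 2, ← Real.rpow_mul hct.le]
          push_cast; ring_nf
        rw [e2]
        exact pow_lt_pow_left₀ hy' (norm_nonneg _) two_ne_zero
      rw [Real.rpow_neg hct.le, ← mul_inv, sub_neg, ← div_eq_mul_inv, div_lt_one hP]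
      exact hy2
    rw [deriv_smoothTransition_of_neg hg, zero_mul]

/-- **Gradient bound on the support of the weight**: if `(c − t)‖∇u(t, y)‖ ≤ δ` for `|y| ≥ R₀(c−t)^n`
on `[0, T]` (`T < c`), then `‖∇u(t, y)‖ ≤ δ/(c − T)` wherever `Θ̂(t, y) ≠ 0`. [folklore] -/
theorem norm_fderiv_le_of_weight_ne_zero (hR : 0 < R₀) (hTc : T < c)
    {v : ℝ → EuclideanSpace ℝ (Fin 3) → EuclideanSpace ℝ (Fin 3)} {δ : ℝ} (hδ : 0 ≤ δ)
    (hgrad : ∀ t ∈ Icc 0 T, ∀ y, R₀ * (c - t) ^ n ≤ ‖y‖ → (c - t) * ‖fderiv ℝ (v t) y‖ ≤ δ)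
    {t : ℝ} (ht : t ∈ Icc 0 T) (y : EuclideanSpace ℝ (Fin 3))
    (hne : Real.smoothTransition (‖y‖ ^ 2 * ((R₀ ^ 2)⁻¹ * (c - t) ^ (-(2 * n))) - 1) ≠ 0) :
    ‖fderiv ℝ (v t) y‖ ≤ δ / (c - T) := by
  have htc : t < c := ht.2.trans_lt hTc
  have hct : 0 < c - t := sub_pos.2 htc
  have hcT : 0 < c - T := sub_pos.2 hTc
  have hy2 := ((weight_values hR htc n y).2.1 hne)
  have hy : R₀ * (c - t) ^ n ≤ ‖y‖ := by
    have e2 : R₀ ^ 2 * (c - t) ^ (2 * n) = (R₀ * (c - t) ^ n) ^ 2 := by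
      rw [mul_pow, ← Real.rpow_natCast ((c - t) ^ n) 2, ← Real.rpow_mul hct.le]
      push_cast; ring_nf
    rw [e2] at hy2
    exact ((pow_lt_pow_iff_left₀ (by positivity) (norm_nonneg _) two_ne_zero).1 hy2).le
  have h1 : ‖fderiv ℝ (v t) y‖ ≤ δ / (c - t) := by
    rw [le_div_iff₀' hct]; exact hgrad t ht y hy
  exact h1.trans (div_le_div_of_nonneg_left hδ hcT (by linarith [ht.2]))

end Weight

end Summit.NavierStokesRegularity.NavierStokesRegularity.Theorems.PowerGaugeEulerLiouville.VorticityDecay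

end
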